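import Literature.AlgebraicGeometry.HodgeTheory.AbelianSchemeRingActionBlockHeightComplexPoint
import Literature.FieldTheory.AlgClosed.PadicAlgClosureEmbedsComplex
import Literature.AlgebraicGeometry.AbelianSchemes.AbelianSchemeFibreAlongIntegralPoint
import Literature.AlgebraicGeometry.Motives.IntegralModelReductionMapSurjective
import Literature.AlgebraicGeometry.AbelianSchemes.PDivisibleGroupBlockRankOfIso
import HarnessLib

/-!
# Socket (S-H) in the datum's frame: the `w`-block of `𝒜[p^∞]` has height `2ef` on the special fibre of the tuple lifted over the
# valuation ring `R ⊆ F̄_w` of a point of the model (frame (R-β) of LEAD M-17w)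

Topic `Literature/AlgebraicGeometry/HodgeTheory`; namespace `Literature.AlgebraicGeometry.HodgeTheory.RingAction`.  THEOREMS ONLY (no
definition, no named fact, no instance, no notation, no `sorry`).  Cell `hodgecm-mathlib` (D-0151), FLOOR 0, P6 «MOD programme» (crux
hLiu418 = stmt-HodgeConjecture-24832, `--supports`): FILE 5 (SUPPLIER, step (4) of the GEN junction spec 2026-09-01T20:33:11Z) of the GEN organ
**(S-H-A)** (A-p18 (g30)).  For an abelian scheme `𝒜` with `𝒪_F`-multiplication over (the total space of) a proper integral model `𝓨`
over `𝒪_{F,(w)}`, of relative dimension `[F : ℚ]`, and a point `y ∈ Y(Ω)`, `Ω = F̄_w`: the tuple LIFTS over the valuation ring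
`R := closureValuationSubring (w.adicCompletion F) ⊆ Ω` along `x̃ := extendPoint … (𝓨.modelPointsEquiv⁻¹ y)` (★ `ProperIntegralPoints`),
`R` is local, `Ω` — hence `R` — embeds into `ℂ` (★ (S-H-E) `PadicAlgClosureEmbedsComplex`), and ★ FILE 4
`hrank_specialFibre_of_complexPoint` delivers the (S-H) binder `hrank` (`h₁ := 2ef`) on the SPECIAL FIBRE `𝒜_R ×_R κ̄(w)` of the
lifted family (closed point `gκ` of ★ `AbelianSchemeFibreAlongIntegralPoint` §2).  The remaining transport to the datum's own special fibre
`sch₀Of 𝓜 w 𝒜 (red y) = (𝒜 ×_𝓨 𝓨_s) ×_{𝓨_s} κ̄` is ★ `exists_iso_fibre_special_along_extendPoint` + ★ DEAL 13 (ISO) `finrank_fixLayer_eq_of_iso`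
(§2); every special point of a SMOOTH proper model IS a reduction `red y` (★ `IntegralModel.geomReductionMap_surjective_of_isSmoothProper`) (§3).

* §1 **`hrank_specialFibre_extendPoint`** — `hrank` for `((𝒜.baseChange x̃.left).baseChange gκ, ((act.baseChange x̃.left).baseChange gκ))`
  at every `y ∈ Y(Ω)`, exponent `n * (2 * e * f)`.
* §2 **`hrank_specialFibre_geomReductionMap`** — `hrank` for `((𝒜.baseChange ι_s).baseChange (red y).left, …)` (the datum's `sch₀Of ∕ actS₀Of`
  shape at `𝓨 := 𝓜.localise w`), at every `y ∈ Y(Ω)`.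
* §3 **`hrank_specialFibre_of_isSmoothProper`** — the same at EVERY `x̄ ∈ 𝓨_s(κ̄(w))` when `𝓨` is smooth and proper: THE ED. 7 `hrank` BINDER
  of `blockDocking_of_line` at `A := sch₀Of 𝓜 w 𝒜 x̄`, exponent `n * (2 * e * f)`.

HC_CM is proved only modulo the printed citations until rung 0 closes; this file is generic and changes no count.

THE PRINT.  [SerreTate1968] §1 (the reduction map; models over the valuation ring); [RapoportSmithlingZhang2020Diagonal] §4.1 (p. 17)
(`A[w^∞]` of height `n·[F_w:ℚ_p]`); [Tate1967] §2 (2.4) (heights are locally constant).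

## References
* [SerreTate1968] J.-P. Serre, J. Tate, *Good reduction of abelian varieties*, Ann. of Math. 88 (1968), §1.
* [RapoportSmithlingZhang2020Diagonal] M. Rapoport, B. Smithling, W. Zhang, Compos. Math. 156 (2020), §4.1 (p. 17).
* [Tate1967] J. T. Tate, *p-divisible groups* (1967), §2 (2.4).
-/

set_option autoImplicit false

noncomputable section

-- `X.toAffine.toAbelianVariety.X = X.X`, `(Over.mk f).left` etc. are definitional only above `instances` transparency.
set_option backward.isDefEq.respectTransparency false

open CategoryTheory CategoryTheory.Limits AlgebraicGeometry
open MonoidalCategory CartesianMonoidalCategory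
open scoped MonObj NumberField CategoryTheory.Obj

namespace Literature.AlgebraicGeometry.HodgeTheory

namespace RingAction

open Literature.AlgebraicGeometry.AbelianSchemes Literature.AlgebraicGeometry.AbelianSchemes.AbelianSchemeOver
open Literature.AlgebraicGeometry.AbelianSchemes.AbelianSchemeOver.RingAction
open Literature.AlgebraicGeometry.GroupSchemes Literature.AlgebraicGeometry.GroupSchemes.IsRingActionBT
open Literature.AlgebraicGeometry.Motives
open Literature.RingTheory.DedekindDomain Literature.FieldTheory.AlgClosed
open IsDedekindDomain IsDedekindDomain.HeightOneSpectrum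
open Literature.NumberTheory.GaloisRepresentations (closureValuationSubring)
open Literature.NumberTheory.DiophantineGeometry

/-! ## §1 `hrank` on the special fibre of the tuple lifted over the valuation ring of a point -/

/-- **SOCKET (S-H) ON THE SPECIAL FIBRE OF THE LIFTED TUPLE.**  `𝓨` a proper integral model over `𝒪_{F,(w)}` of a `F`-scheme `Y`,
`𝒜 → 𝓨` an abelian scheme of relative dimension `[F : ℚ]` with `act : RingAction (𝓞 F) 𝒜`, `y ∈ Y(F̄_w)`; `R ⊆ F̄_w` the valuation ring,
`x̃ : Spec R → 𝓨` the lift of `y` (valuative criterion), `gκ : Spec κ̄(w) → Spec R` the closed point.  For a prime `w′ ∣ p` of `𝒪_F` with block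
data `(e, 𝔟, f, a)`: the fixed layers of the block idempotent `β(a)` of `(𝒜_R ×_R κ̄)[p^∞]` have rank `p ^ (n * (2 * e * f))` — ★ FILE 4
`hrank_specialFibre_of_complexPoint` at the complex point `Spec ℂ → Spec R` given by `R ⊆ F̄_w ↪ ℂ` (★ `nonempty_ringHom_algebraicClosure_adicCompletion_complex`).
[cite: SerreTate1968, §1] [cite: RapoportSmithlingZhang2020Diagonal, §4.1 (p. 17)] [cite: Tate1967, §2 (2.4)] -/
theorem hrank_specialFibre_extendPoint {F : Type} [Field F] [NumberField F] {w : HeightOneSpectrum (𝓞 F)} {Y : SchemeOver F}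
    (𝓨 : IntegralModel (valuationSubringAtPrime F w) F Y) [IsProper 𝓨.total.hom]
    {𝒜 : AbelianSchemeOver 𝓨.total.left} [IsCommMonObj 𝒜.X] (hg : 𝒜.IsOfRelDim (Module.finrank ℚ F)) (act : RingAction (𝓞 F) 𝒜)
    {p : ℕ} (hp : p ≠ 0) (w' : Ideal (𝓞 F)) [w'.IsMaximal] (hw0 : w' ≠ ⊥) {f : ℕ} (hf : Nat.card (𝓞 F ⧸ w') = p ^ f)
    {e : ℕ} {𝔟 : Ideal (𝓞 F)} (hx : Ideal.span {(p : 𝓞 F)} = w' ^ e * 𝔟) (hcop : w' ⊔ 𝔟 = ⊤)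
    (a : ℕ → 𝓞 F) (ha1 : ∀ n, a n - 1 ∈ w' ^ (e * n)) (ha2 : ∀ n, a n ∈ 𝔟 ^ n)
    (y : AlgPoints Y (AlgebraicClosure (w.adicCompletion F))) (n : ℕ) (s : ↥(Spec (.of (geomResidueField w)))) :
    letI xt : Spec (.of ↥(closureValuationSubring (w.adicCompletion F))) ⟶ 𝓨.total.left :=
      (extendPoint (closureValuationSubring (w.adicCompletion F)) (toClosureValuationSubring w) 𝓨.total (𝓨.modelPointsEquiv.symm y)).left
    letI gκ : Spec (.of (geomResidueField w)) ⟶ Spec (.of ↥(closureValuationSubring (w.adicCompletion F))) :=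
      (geomClosedPointIsoSpecResidueField w).inv.left ≫
        (specRingHomι (closureValuationSubring (w.adicCompletion F)) (toClosureValuationSubring w)
          (IsLocalRing.residue ↥(closureValuationSubring (w.adicCompletion F)))).left
    haveI : IsCommMonObj (((𝒜.baseChange xt).baseChange gκ).X) :=
      inferInstanceAs (IsCommMonObj ((Over.pullback gκ).obj ((Over.pullback xt).obj 𝒜.X)))
    (((isRingActionBT_pDivisibleGroupMap ((act.baseChange xt).baseChange gκ) hp ((hg.baseChange xt).baseChange gκ)).homOfCompatibleFamily a
        (sub_mem_span_pow hx hcop ha1 ha2)).fixLayer n).hom.finrank s = p ^ (n * (2 * e * f)) := by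
  -- the complex point of `Spec R`: `R ⊆ F̄_w ↪ ℂ`
  obtain ⟨Φ⟩ := nonempty_ringHom_algebraicClosure_adicCompletion_complex F w
  let gℂ : Spec (.of ℂ) ⟶ Spec (.of ↥(closureValuationSubring (w.adicCompletion F))) :=
    Spec.map (CommRingCat.ofHom (Φ.comp (closureValuationSubring (w.adicCompletion F)).subtype))
  haveI : IsCommMonObj (𝒜.baseChange (extendPoint (closureValuationSubring (w.adicCompletion F)) (toClosureValuationSubring w)
      𝓨.total (𝓨.modelPointsEquiv.symm y)).left).X :=
    inferInstanceAs (IsCommMonObj ((Over.pullback _).obj 𝒜.X))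
  haveI : IsCommMonObj ((𝒜.baseChange (extendPoint (closureValuationSubring (w.adicCompletion F)) (toClosureValuationSubring w)
      𝓨.total (𝓨.modelPointsEquiv.symm y)).left).baseChange gℂ).X :=
    inferInstanceAs (IsCommMonObj ((Over.pullback gℂ).obj ((Over.pullback _).obj 𝒜.X)))
  haveI : IsCommMonObj ((𝒜.baseChange (extendPoint (closureValuationSubring (w.adicCompletion F)) (toClosureValuationSubring w)
      𝓨.total (𝓨.modelPointsEquiv.symm y)).left).baseChange ((geomClosedPointIsoSpecResidueField w).inv.left ≫
        (specRingHomι (closureValuationSubring (w.adicCompletion F)) (toClosureValuationSubring w)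
          (IsLocalRing.residue ↥(closureValuationSubring (w.adicCompletion F)))).left)).X :=
    inferInstanceAs (IsCommMonObj ((Over.pullback _).obj ((Over.pullback _).obj 𝒜.X)))
  exact hrank_specialFibre_of_complexPoint (hg.baseChange _) (act.baseChange _) hp w' hw0 hf hx hcop a ha1 ha2 gℂ _ n s

/-! ## §2 `hrank` on the datum's own special fibre `(𝒜 ×_𝓨 𝓨_s) ×_{𝓨_s} x̄` at a reduction `x̄ = red_𝓨 y` -/

/-- **SOCKET (S-H) AT A REDUCTION `red_𝓨 y`.**  Same data; the fibre of the special family `𝒜 ×_𝓨 𝓨_s → 𝓨_s` at the reduction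
`red_𝓨 y : Spec κ̄(w) → 𝓨_s` of `y ∈ Y(F̄_w)` — the datum's `sch₀Of 𝓜 w 𝒜 (red y)` at `𝓨 := 𝓜.localise w`, with the doubly base-changed action —
has block layers of rank `p ^ (n * (2 * e * f))`: it is isomorphic, compatibly with every `ι(r)`, to the special fibre of the lifted family
(★ `exists_iso_fibre_special_along_extendPoint`: «reduction of points = reduction of tuples»), and block ranks move along equivariant
isomorphisms (★ `finrank_fixLayer_eq_of_iso`); then §1. [cite: SerreTate1968, §1] [cite: Tate1967, §2 (2.1) and (2.4)]
[cite: RapoportSmithlingZhang2020Diagonal, §4.1 (p. 17)] -/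
theorem hrank_specialFibre_geomReductionMap {F : Type} [Field F] [NumberField F] {w : HeightOneSpectrum (𝓞 F)} {Y : SchemeOver F}
    (𝓨 : IntegralModel (valuationSubringAtPrime F w) F Y) [IsProper 𝓨.total.hom]
    {𝒜 : AbelianSchemeOver 𝓨.total.left} [IsCommMonObj 𝒜.X] (hg : 𝒜.IsOfRelDim (Module.finrank ℚ F)) (act : RingAction (𝓞 F) 𝒜)
    {p : ℕ} (hp : p ≠ 0) (w' : Ideal (𝓞 F)) [w'.IsMaximal] (hw0 : w' ≠ ⊥) {f : ℕ} (hf : Nat.card (𝓞 F ⧸ w') = p ^ f)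
    {e : ℕ} {𝔟 : Ideal (𝓞 F)} (hx : Ideal.span {(p : 𝓞 F)} = w' ^ e * 𝔟) (hcop : w' ⊔ 𝔟 = ⊤)
    (a : ℕ → 𝓞 F) (ha1 : ∀ n, a n - 1 ∈ w' ^ (e * n)) (ha2 : ∀ n, a n ∈ 𝔟 ^ n)
    (y : AlgPoints Y (AlgebraicClosure (w.adicCompletion F)))
    [IsCommMonObj (((𝒜.baseChange (pullback.fst 𝓨.total.hom (specResidueField w))).baseChange
      ((𝓨.geomReductionMap y).left : Spec (.of (geomResidueField w)) ⟶ pullback 𝓨.total.hom (specResidueField w))).X)]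
    (n : ℕ) (s : ↥(Spec (.of (geomResidueField w)))) :
    letI ιs := pullback.fst 𝓨.total.hom (specResidueField w)
    letI xb : Spec (.of (geomResidueField w)) ⟶ pullback 𝓨.total.hom (specResidueField w) := (𝓨.geomReductionMap y).left
    (((isRingActionBT_pDivisibleGroupMap (((act.baseChange ιs).baseChange xb : ((𝒜.baseChange ιs).baseChange xb).RingAction (𝓞 F)))
        hp ((hg.baseChange ιs).baseChange xb)).homOfCompatibleFamily a (sub_mem_span_pow hx hcop ha1 ha2)).fixLayer n).hom.finrank s =
      p ^ (n * (2 * e * f)) := by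
  obtain ⟨eI, -, hnat⟩ := exists_iso_fibre_special_along_extendPoint 𝓨 y
  -- the lifted side: `x̃ : Spec R → 𝓨`, `gκ : Spec κ̄ → Spec R`
  let xt : Spec (.of ↥(closureValuationSubring (w.adicCompletion F))) ⟶ 𝓨.total.left :=
    (extendPoint (closureValuationSubring (w.adicCompletion F)) (toClosureValuationSubring w) 𝓨.total (𝓨.modelPointsEquiv.symm y)).left
  let gκ : Spec (.of (geomResidueField w)) ⟶ Spec (.of ↥(closureValuationSubring (w.adicCompletion F))) :=
    (geomClosedPointIsoSpecResidueField w).inv.left ≫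
      (specRingHomι (closureValuationSubring (w.adicCompletion F)) (toClosureValuationSubring w)
        (IsLocalRing.residue ↥(closureValuationSubring (w.adicCompletion F)))).left
  let ιs := pullback.fst 𝓨.total.hom (specResidueField w)
  let xb : Spec (.of (geomResidueField w)) ⟶ pullback 𝓨.total.hom (specResidueField w) := (𝓨.geomReductionMap y).left
  haveI : IsCommMonObj ((𝒜.baseChange xt).X) := inferInstanceAs (IsCommMonObj ((Over.pullback xt).obj 𝒜.X))
  haveI : IsCommMonObj (((𝒜.baseChange xt).baseChange gκ).X) :=
    inferInstanceAs (IsCommMonObj ((Over.pullback gκ).obj ((Over.pullback xt).obj 𝒜.X)))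
  -- the equivariant isomorphism of the two special fibres, as an isomorphism of `κ̄`-group schemes
  let φ : ((𝒜.baseChange ιs).baseChange xb).X ≅ ((𝒜.baseChange xt).baseChange gκ).X :=
    ⟨(eI 𝒜).hom.hom.hom.hom, (eI 𝒜).inv.hom.hom.hom, congrArg (fun ψ => ψ.hom.hom.hom) (eI 𝒜).hom_inv_id,
      congrArg (fun ψ => ψ.hom.hom.hom) (eI 𝒜).inv_hom_id⟩
  haveI : IsMonHom φ.hom := inferInstanceAs (IsMonHom (eI 𝒜).hom.hom.hom.hom)
  have hφ : ∀ r, φ.hom ≫ ((act.baseChange xt).baseChange gκ).i r = ((act.baseChange ιs).baseChange xb).i r ≫ φ.hom := fun r => by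
    haveI := act.isMonHom_i r
    exact (congrArg (fun ψ => ψ.hom.hom.hom) (hnat 𝒜 𝒜 (act.i r))).symm
  have key := finrank_fixLayer_eq_of_iso ((hg.baseChange ιs).baseChange xb) ((hg.baseChange xt).baseChange gκ) hp
    ((act.baseChange ιs).baseChange xb) ((act.baseChange xt).baseChange gκ) φ hφ a (sub_mem_span_pow hx hcop ha1 ha2)
    (mul_self_sub_mem_span_pow hx hcop ha1 ha2) n s
  exact key.trans (hrank_specialFibre_extendPoint 𝓨 hg act hp w' hw0 hf hx hcop a ha1 ha2 y n s)

/-! ## §3 `hrank` at EVERY special point of a smooth proper model -/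

/-- **SOCKET (S-H) AT EVERY SPECIAL POINT (the ED. 7 `hrank` binder of `blockDocking_of_line` at `A := sch₀Of 𝓜 w 𝒜 x̄`).**  For a smooth
proper integral model `𝓨` over `𝒪_{F,(w)}`, an abelian scheme `𝒜 → 𝓨` of relative dimension `[F : ℚ]` with `𝒪_F`-action `act`, a prime
`w′` of `𝒪_F` with block data `(p, e, 𝔟, f, a)` and ANY `x̄ ∈ 𝓨_s(κ̄(w))`: the fixed layers of the block idempotent `β(a)` of
`((𝒜 ×_𝓨 𝓨_s) ×_{𝓨_s} x̄)[p^∞]` have rank `p ^ (n * (2 * e * f))` at every point — every special point is a reduction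
(★ `IntegralModel.geomReductionMap_surjective_of_isSmoothProper`, Hensel), then §2. [cite: SerreTate1968, §1]
[cite: RapoportSmithlingZhang2020Diagonal, §4.1 (p. 17)] [cite: Tate1967, §2 (2.4)] -/
theorem hrank_specialFibre_of_isSmoothProper {F : Type} [Field F] [NumberField F] {w : HeightOneSpectrum (𝓞 F)} {Y : SchemeOver F}
    (𝓨 : IntegralModel (valuationSubringAtPrime F w) F Y) {d : ℕ} (h𝓨 : 𝓨.IsSmoothProper d)
    {𝒜 : AbelianSchemeOver 𝓨.total.left} [IsCommMonObj 𝒜.X] (hg : 𝒜.IsOfRelDim (Module.finrank ℚ F)) (act : RingAction (𝓞 F) 𝒜)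
    {p : ℕ} (hp : p ≠ 0) (w' : Ideal (𝓞 F)) [w'.IsMaximal] (hw0 : w' ≠ ⊥) {f : ℕ} (hf : Nat.card (𝓞 F ⧸ w') = p ^ f)
    {e : ℕ} {𝔟 : Ideal (𝓞 F)} (hx : Ideal.span {(p : 𝓞 F)} = w' ^ e * 𝔟) (hcop : w' ⊔ 𝔟 = ⊤)
    (a : ℕ → 𝓞 F) (ha1 : ∀ n, a n - 1 ∈ w' ^ (e * n)) (ha2 : ∀ n, a n ∈ 𝔟 ^ n)
    (xbar : AlgPoints 𝓨.reductionAt (geomResidueField w))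
    [IsCommMonObj (((𝒜.baseChange (pullback.fst 𝓨.total.hom (specResidueField w))).baseChange
      (xbar.left : Spec (.of (geomResidueField w)) ⟶ pullback 𝓨.total.hom (specResidueField w))).X)]
    (n : ℕ) (s : ↥(Spec (.of (geomResidueField w)))) :
    letI ιs := pullback.fst 𝓨.total.hom (specResidueField w)
    letI xb : Spec (.of (geomResidueField w)) ⟶ pullback 𝓨.total.hom (specResidueField w) := xbar.left
    (((isRingActionBT_pDivisibleGroupMap (((act.baseChange ιs).baseChange xb : ((𝒜.baseChange ιs).baseChange xb).RingAction (𝓞 F)))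
        hp ((hg.baseChange ιs).baseChange xb)).homOfCompatibleFamily a (sub_mem_span_pow hx hcop ha1 ha2)).fixLayer n).hom.finrank s =
      p ^ (n * (2 * e * f)) := by
  haveI := h𝓨.2
  obtain ⟨y, rfl⟩ := 𝓨.geomReductionMap_surjective_of_isSmoothProper h𝓨 xbar
  exact hrank_specialFibre_geomReductionMap 𝓨 hg act hp w' hw0 hf hx hcop a ha1 ha2 y n s

end RingAction

end Literature.AlgebraicGeometry.HodgeTheory
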